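import Summits.QuantumFields.YangMills.Theses.RecentredCoverTransfer
import Summits.QuantumFields.YangMills.Theorems.RecentredCoverTransferCellPartialMoments
import Summits.QuantumFields.YangMills.Theorems.BalabanLadderNTBoundaryLawReferenceValue
import HarnessLib

/-!
# Route `RecentredCoverTransfer` (LINE g9-D of planner ym-idea-1 g9, «restrict-then-tighten»), glue item
# `OnePointRateOfBoundaryLaw` (stmt-QuantumFields-23166), PROVED

`PhysicalDepthBoundaryLaw → CellCubeDLR → OnePointRate`.

Proof (the planner's docstring, in substance).  Fix the binders of `OnePointRate` and `ε > 0`; the physical-depth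
boundary law gives `β₁, ℓ₁ > 0` and reference values `p q β`.  Along the leg scheme `β_k → ∞` and `a_k = a(β_k) → 0`, so
eventually `β_k ≥ β₁` and `ℓ₁ a_k < 1/2`; for such `k` put `N_k := ⌈ℓ₁ / a_k⌉₊ ≥ 1` and take the cube of radius `N_k`
around the origin, `(c, b) = (−N_k, 2N_k + 1)`: its physical side is `≥ ℓ₁`, the origin has depth `N_k + 1`
(`4·depth ≥ b`), and `N_k + 3 ≤ a_k⁻² ≤ L_k` (leg-scheme clause `a_k⁻² ≤ L_k`, `a_k ≤ 1/24`), so the cube sits inside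
the straight torus of side `2L_k + 1` and its `2`-thickened window is injective modulo the period lattice
`(2L_k+1)·D₄` of the checkerboard cell (coordinate differences `≤ 2N_k + 5 < 2L_k + 1`).
The action density is the sum of the six single-plane plaquette fields at the origin (`dens_eq_sum_filter_plane`);
each is a bounded continuous cylinder observable supported in the unit plaquettes at `0 ⊆ [c, c + b]`.  TORUS: by the
one-cube torus DLR identity the torus mean of a plane field is the torus average of its cube-kernel means, all within
`ε a_k⁴` of `p q β_k` (tree `NT.BoundaryLaw.abs_torusE_sub_le_of_kernel`).  CELL: by the hypothesis `CellCubeDLR` the cell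
mean is the cell average of the same kernel means (`abs_integral_cellLift_sub_le_of_kernel`), within `ε a_k⁴` of `p q β_k`
too.  Summing over the six orientations, `|m_T(k) − m_C(k)| ≤ 12 ε a_k⁴` eventually, i.e. `a_k⁻⁴ |m_T(k) − m_C(k)| ≤ 12ε`
eventually for every `ε > 0`.

Width seat `ym-line-sfw-p2-w5` g10 (cell ym-idea-1, free hands; crux 22884 has no free stub).  THEOREMS ONLY, definition-free.
HONEST FRAMING: the children `PhysicalDepthBoundaryLaw` (stmt-QuantumFields-23164, the IR/DLR-uniqueness wall at physical
depth) and `CellCubeDLR` (stmt-QuantumFields-23165) are OPEN; this glue proves no crux, no rung (R2d ROT is a RECORD rung)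
and no summit; the Yang–Mills mass gap is not proved by any of this.  References: Georgii, *Gibbs Measures and Phase
Transitions* (2011) Def. 2.9 / (5.3); Glimm–Jaffe (1987) §6.1; E. Seiler, LNP 159 (1982) Ch. 2. [folklore]
-/

set_option autoImplicit false

noncomputable section

open scoped BigOperators
open MeasureTheory Filter Topology
open Literature.MathematicalPhysics.QuantumFieldTheory Literature.MathematicalPhysics.QuantumLattice
open Literature.MathematicalPhysics.AQFT
open Literature.Probability.LatticeModels (box Site)
open Summit.QuantumFields.YangMills.Theorems.ROT
open Summit.QuantumFields.YangMills.Cruxes.OSLegsFromFemtoAndGap.DlrCollarTransfer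
open Summit.QuantumFields.YangMills.Theorems.OSLegsFromFemtoAndGap
  (dens_eq_sum_filter_plane card_planes measurable_plane_lift)
open Summit.QuantumFields.YangMills.Cruxes.NT.BoundaryLaw (abs_torusE_sub_le_of_kernel succ_le_depth_centre abs_kerE_le)

namespace Summit.QuantumFields.YangMills.Theorems.RecentredCoverTransfer

variable {G : Type} [Group G] [TopologicalSpace G] [IsTopologicalGroup G] [CompactSpace G]
  [MeasurableSpace G] [BorelSpace G]

/-! ## §1 Kernel-to-cell transfer of a one-point bound (the cell twin of `abs_torusE_sub_le_of_kernel`) -/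

/-- **Kernel-to-cell transfer of a one-point bound.**  If the cell law satisfies the one-cube DLR identity for a bounded
continuous observable `F` and the cube `(c, b)` (the hypothesis `hDLR`, an instance of `CellCubeDLR`), and every cube-kernel
mean of `F` is within `h` of `p`, then the cell mean of `F` (read through the periodic lift) is within `h` of `p`: Wilson's
law on the cell is a probability measure. [folklore] -/
theorem abs_integral_cellLift_sub_le_of_kernel (Ce : PeriodCell 4) (r : LatticeRep G) (β : ℝ) (c : Fin 4 → ℤ) (b : ℕ)
    {F : LGConfig 4 G → ℝ} (hF : Continuous F) {M : ℝ} (hM : ∀ U, |F U| ≤ M)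
    (hDLR : ∫ U, kerE G r β c b (Ce.lift U) F ∂(Ce.measure r.ρ β) = ∫ U, F (Ce.lift U) ∂(Ce.measure r.ρ β))
    {p h : ℝ} (hker : ∀ η, |kerE G r β c b η F - p| ≤ h) :
    |∫ U, F (Ce.lift U) ∂(Ce.measure r.ρ β) - p| ≤ h := by
  haveI := r.secondCountableTopology
  haveI := Ce.isProbabilityMeasure_measure (G := G) r.ρ r.continuous β
  rw [← hDLR]
  set f : Ce.Config G → ℝ := fun U => kerE G r β c b (Ce.lift U) F with hf
  have hfc : Continuous fun η : LGConfig 4 G => kerE G r β c b η F := by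
    unfold kerE
    exact continuous_integral_ymSpecification r.ρ r.continuous β _ hF hM
  have hfm : Measurable f := hfc.measurable.comp (measurable_cellLift Ce)
  have hfb : ∀ U, |f U| ≤ M := fun U => abs_kerE_le G r β _ _ _ hM
  have hfi : Integrable f (Ce.measure r.ρ β) :=
    Integrable.of_bound (C := M) hfm.aestronglyMeasurable
      (Eventually.of_forall fun U => by rw [Real.norm_eq_abs]; exact hfb U)
  have hsub : ∫ U, f U ∂(Ce.measure r.ρ β) - p = ∫ U, (f U - p) ∂(Ce.measure r.ρ β) := by
    rw [integral_sub hfi (integrable_const p), integral_const, smul_eq_mul, probReal_univ, one_mul]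
  change |∫ U, f U ∂(Ce.measure r.ρ β) - p| ≤ h
  rw [hsub]
  have key := norm_integral_le_of_norm_le_const (μ := Ce.measure r.ρ β) (f := fun U => f U - p) (C := h)
    (Eventually.of_forall fun U => by rw [Real.norm_eq_abs]; exact hker _)
  simpa [Real.norm_eq_abs] using key

/-! ## §2 The action density and the torus mean as orientation sums -/

/-- The curvature species is the sum of the six single-plane plaquette fields at the origin (`dens 0 = Σ_q plane q 0`,
and `dens 0 = r.curvature.F` since the shift by `0` is the identity). [folklore] -/
theorem curvature_eq_sum_plane (r : LatticeRep G) (V : LGConfig 4 G) :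
    r.curvature.F V = ∑ q ∈ Finset.univ.filter (fun q : Fin 4 × Fin 4 => q.1 < q.2), plane G r q 0 V := by
  have h0 : configShift (0 : Site 4) V = V := by
    funext e
    rw [configShift_apply, sub_zero]
  have h : dens G r 0 V = r.curvature.F V := by
    simp only [dens, neg_zero, h0]
  rw [← h, dens_eq_sum_filter_plane r 0 V]

/-- The torus Wilson mean of the action density is the sum of the torus means of the six plane fields at the origin.
[folklore] -/
theorem wilsonTorusMean_curvature_eq_sum (r : LatticeRep G) (β : ℝ) (L : ℕ) :
    wilsonTorusMean r.ρ β L r.curvature.F =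
      ∑ q ∈ Finset.univ.filter (fun q : Fin 4 × Fin 4 => q.1 < q.2), torusE G r β L (plane G r q 0) := by
  haveI := r.secondCountableTopology
  haveI := isProbabilityMeasure_wilsonMeasure (d := 4) (L := 2 * L + 1) r.ρ r.continuous β
  obtain ⟨Cp, hCp⟩ := exists_abs_plane_le (G := G) r
  unfold wilsonTorusMean torusE
  rw [← integral_finsetSum _ (fun q _ => Integrable.of_bound (C := Cp) (measurable_plane_lift r L q 0).aestronglyMeasurable
    (Eventually.of_forall fun U => by rw [Real.norm_eq_abs]; exact hCp q 0 _))]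
  exact integral_congr_ae (Eventually.of_forall fun U => curvature_eq_sum_plane r _)

/-- The cell Wilson mean of the action density is the sum of the cell means of the six plane fields at the origin, read
through the periodic lift. [folklore] -/
theorem cellMean_curvature_eq_sum (Ce : PeriodCell 4) (r : LatticeRep G) (β : ℝ) :
    Ce.mean r.ρ β r.curvature.F =
      ∑ q ∈ Finset.univ.filter (fun q : Fin 4 × Fin 4 => q.1 < q.2), ∫ U, plane G r q 0 (Ce.lift U) ∂(Ce.measure r.ρ β) := by
  rw [mean_curvature_eq_sum_plane Ce r β]
  exact Finset.sum_congr rfl fun q _ => (integral_plane_cellLift_eq Ce r β q 0).symm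

/-! ## §3 Geometry of the centred cube: window injectivity modulo the checkerboard period lattice -/

/-- **Window injectivity.**  If the period lattice is `(2L+1)·{w : Σ w even}` and `b + 5 ≤ 2L + 1`, the `2`-thickened window
of the cube `(c, b)` reduces injectively modulo the period lattice: two window sites differ by at most `b + 4 < 2L + 1` in
every coordinate, while a nonzero period has a coordinate of modulus `≥ 2L + 1`. [folklore] -/
theorem window_injective_of_period {L : ℕ} (P : AddSubgroup (Site 4))
    (hP : (P : Set (Fin 4 → ℤ)) = {z | ∃ w : Fin 4 → ℤ, Even (∑ i, w i) ∧ z = ((2 * L + 1 : ℕ) : ℤ) • w})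
    (c : Fin 4 → ℤ) (b : ℕ) (hb : b + 5 ≤ 2 * L + 1) :
    ∀ z w : Fin 4 → ℤ, (∀ j, c j - 2 ≤ z j ∧ z j ≤ c j + b + 2) → (∀ j, c j - 2 ≤ w j ∧ w j ≤ c j + b + 2) →
      z - w ∈ P → z = w := by
  intro z w hz hw hzw
  have hmem : z - w ∈ (P : Set (Fin 4 → ℤ)) := hzw
  rw [hP] at hmem
  obtain ⟨v, -, hv⟩ := hmem
  funext j
  have hj : z j - w j = ((2 * L + 1 : ℕ) : ℤ) * v j := by
    have := congr_fun hv j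
    simpa [Pi.sub_apply, Pi.smul_apply, smul_eq_mul] using this
  obtain ⟨hz1, hz2⟩ := hz j
  obtain ⟨hw1, hw2⟩ := hw j
  have hL : ((b : ℤ) + 5) ≤ ((2 * L + 1 : ℕ) : ℤ) := by exact_mod_cast hb
  rcases lt_trichotomy (v j) 0 with hv0 | hv0 | hv0
  · exfalso
    have h1 : ((2 * L + 1 : ℕ) : ℤ) * v j ≤ ((2 * L + 1 : ℕ) : ℤ) * (-1) :=
      mul_le_mul_of_nonneg_left (by omega) (by positivity)
    omega
  · have : z j - w j = 0 := by rw [hj, hv0, mul_zero]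
    omega
  · exfalso
    have h1 : ((2 * L + 1 : ℕ) : ℤ) * 1 ≤ ((2 * L + 1 : ℕ) : ℤ) * v j :=
      mul_le_mul_of_nonneg_left (by omega) (by positivity)
    omega

/-- The support window of a plane field at the origin lies inside the cube of radius `N ≥ 1` around the origin, in the
form the torus transfer lemma wants. [folklore] -/
theorem plane_window_origin (q : Fin 4 × Fin 4) {N : ℕ} (hN : 1 ≤ N) :
    ∀ e ∈ (originPlaquetteSupport q.1 q.2).image (fun e => (e.1 - -(0 : Fin 4 → ℤ), e.2)), ∀ j,
      (0 : Fin 4 → ℤ) j - N ≤ e.1 j ∧ e.1 j ≤ (0 : Fin 4 → ℤ) j + N := fun e he j => by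
  obtain ⟨h0, h1⟩ := near_of_mem_supp_plane he j
  simp only [Pi.zero_apply, sub_zero] at h0 h1 ⊢
  have hN' : (1 : ℤ) ≤ N := by exact_mod_cast hN
  constructor <;> omega

/-- The same window in the form the cell DLR identity wants: `c j ≤ e.1 j ≤ c j + b` for `(c, b) = (−N, 2N+1)`. [folklore] -/
theorem plane_window_origin' (q : Fin 4 × Fin 4) (N : ℕ) :
    ∀ e ∈ (originPlaquetteSupport q.1 q.2).image (fun e => (e.1 - -(0 : Fin 4 → ℤ), e.2)), ∀ j,
      (fun j : Fin 4 => (0 : Fin 4 → ℤ) j - (N : ℤ)) j ≤ e.1 j ∧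
        e.1 j ≤ (fun j : Fin 4 => (0 : Fin 4 → ℤ) j - (N : ℤ)) j + ((2 * N + 1 : ℕ) : ℤ) := fun e he j => by
  obtain ⟨h0, h1⟩ := near_of_mem_supp_plane he j
  simp only [Pi.zero_apply, sub_zero] at h0 h1 ⊢
  push_cast
  constructor <;> omega

/-! ## §4 The leg-scheme arithmetic: the cube of radius `⌈ℓ₁/a⌉₊` fits -/

/-- If `0 < α ≤ 1/24`, `0 < ℓ₁`, `ℓ₁ α < 1/2` and `α⁻² ≤ L`, then `N := ⌈ℓ₁/α⌉₊` satisfies `N + 3 ≤ L`. [folklore] -/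
theorem ceil_add_three_le {α ℓ₁ : ℝ} {L : ℕ} (hα : 0 < α) (hα24 : α ≤ 1 / 24) (hℓ₁ : 0 < ℓ₁) (hℓ : ℓ₁ * α < 1 / 2)
    (hL : α⁻¹ * α⁻¹ ≤ L) : ⌈ℓ₁ / α⌉₊ + 3 ≤ L := by
  have hα2 : 0 < α ^ 2 := by positivity
  have hkey : ℓ₁ / α + 4 ≤ α⁻¹ * α⁻¹ := by
    have e1 : ℓ₁ / α + 4 = (ℓ₁ * α + 4 * α ^ 2) / α ^ 2 := by
      field_simp
    have e2 : α⁻¹ * α⁻¹ = 1 / α ^ 2 := by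
      field_simp
    rw [e1, e2]
    apply div_le_div_of_nonneg_right _ hα2.le
    nlinarith
  have hceil : (⌈ℓ₁ / α⌉₊ : ℝ) < ℓ₁ / α + 1 := Nat.ceil_lt_add_one (by positivity)
  have h : ((⌈ℓ₁ / α⌉₊ + 3 : ℕ) : ℝ) < L := by
    push_cast
    linarith
  exact_mod_cast h.le

/-! ## §5 The glue -/

/-- **LINE g9-D glue** `PhysicalDepthBoundaryLaw → CellCubeDLR → OnePointRate` (stmt-QuantumFields-23166): the torus and the
checkerboard double cover have the same vacuum energy density to physical precision `o(a⁴)` once the conditional energy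
density deep inside a physically large cube forgets its boundary condition to that precision (PDBL) and the cell law is
Gibbs for the cube (CellCubeDLR).  No crux, rung or summit is proved. [folklore] -/
theorem onePointRateOfBoundaryLaw_proof :
    Summit.QuantumFields.YangMills.Theses.RecentredCoverTransfer.OnePointRateOfBoundaryLaw := by
  intro hP hD G _ _ _ _ hG
  letI : MeasurableSpace G := borel G
  haveI : BorelSpace G := ⟨rfl⟩
  intro r a ha ha0 _hMB sch hsch C hC
  haveI := r.secondCountableTopology
  obtain ⟨Cp, hCp⟩ := exists_abs_plane_le (G := G) r
  -- the eventual bound `|a_k⁻⁴ (m_T − m_C)| ≤ 12 ε`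
  have hmain : ∀ ε : ℝ, 0 < ε → ∀ᶠ k in atTop,
      |((sch.a k)⁻¹) ^ 4 * (wilsonTorusMean r.ρ (sch.β k) (sch.L k) r.curvature.F -
        (C k).mean r.ρ (sch.β k) r.curvature.F)| ≤ 12 * ε := by
    intro ε hε
    obtain ⟨β₁, ℓ₁, p, hℓ₁, H⟩ := hP G hG r a ha ha0 ε hε
    have hβ : Tendsto sch.β atTop atTop := hsch.2.1
    have hak : Tendsto (fun k => a (sch.β k)) atTop (nhds 0) := ha0.comp hβ
    have E1 : ∀ᶠ k in atTop, β₁ ≤ sch.β k := Filter.tendsto_atTop.1 hβ β₁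
    have E2 : ∀ᶠ k in atTop, a (sch.β k) < 1 / (2 * ℓ₁) := hak.eventually (gt_mem_nhds (by positivity))
    filter_upwards [E1, E2] with k hk1 hk2
    -- abbreviations
    obtain ⟨-, hα24, -, hLk⟩ := hsch.2.2 k
    have haeq : sch.a k = a (sch.β k) := hsch.1 k
    set β := sch.β k with hβdef
    set L := sch.L k with hLdef
    set α := a β with hαdef
    have hα : 0 < α := ha β
    rw [haeq] at hα24 hLk
    have hℓα : ℓ₁ * α < 1 / 2 := by
      have := (lt_div_iff₀ (by positivity : (0 : ℝ) < 2 * ℓ₁)).1 hk2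
      linarith
    set N := ⌈ℓ₁ / α⌉₊ with hNdef
    have hN1 : 1 ≤ N := Nat.one_le_iff_ne_zero.2 (Nat.pos_iff_ne_zero.1 (Nat.ceil_pos.2 (by positivity)))
    have hNL : N + 3 ≤ L := ceil_add_three_le hα hα24 hℓ₁ hℓα hLk
    have hN1L : N + 1 ≤ L := by omega
    have hb5 : (2 * N + 1) + 5 ≤ 2 * L + 1 := by omega
    have hℓb : ℓ₁ ≤ ((2 * N + 1 : ℕ) : ℝ) * a β := by
      have h1 : ℓ₁ / α ≤ N := Nat.le_ceil _
      rw [div_le_iff₀ hα] at h1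
      have h2 : (N : ℝ) * α ≤ ((2 * N + 1 : ℕ) : ℝ) * α := by
        apply mul_le_mul_of_nonneg_right _ hα.le
        push_cast; linarith
      exact h1.trans h2
    have hdepth : 2 * N + 1 ≤ 4 * depth (fun j => (0 : Fin 4 → ℤ) j - N) (2 * N + 1) 0 := by
      have := succ_le_depth_centre (0 : Fin 4 → ℤ) N
      omega
    -- the kernel bound of PDBL for every plane field at the origin, every exterior
    have hker : ∀ (q : Fin 4 × Fin 4), q.1 < q.2 → ∀ η : LGConfig 4 G,
        |kerE G r β (fun j => (0 : Fin 4 → ℤ) j - N) (2 * N + 1) η (plane G r q 0) - p q β| ≤ ε * (a β) ^ 4 :=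
      fun q hq η => H β hk1 _ _ hℓb η q 0 hq hdepth
    -- TORUS: every plane mean within `ε a⁴` of `p q`
    have hT : ∀ q : Fin 4 × Fin 4, q.1 < q.2 → |torusE G r β L (plane G r q 0) - p q β| ≤ ε * (a β) ^ 4 :=
      fun q hq => abs_torusE_sub_le_of_kernel G r β 0 N L hN1L (continuous_plane r q 0) (hCp q 0)
        (isCylinder_plane r q 0) (plane_window_origin q hN1) (hker q hq)
    -- CELL: the DLR identity of the hypothesis, then the same transfer
    have hinj := window_injective_of_period (C k).P (hC k).1 (fun j => (0 : Fin 4 → ℤ) j - N) (2 * N + 1) hb5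
    have hCe : ∀ q : Fin 4 × Fin 4, q.1 < q.2 →
        |∫ U, plane G r q 0 ((C k).lift U) ∂((C k).measure r.ρ β) - p q β| ≤ ε * (a β) ^ 4 := fun q hq => by
      have hDLR := hD G r (C k) β (fun j => (0 : Fin 4 → ℤ) j - N) (2 * N + 1) hinj (plane G r q 0)
        (measurable_plane r q 0) ⟨Cp, hCp q 0⟩ _ (isCylinder_plane r q 0) (plane_window_origin' q N)
      exact abs_integral_cellLift_sub_le_of_kernel (C k) r β _ _ (continuous_plane r q 0) (hCp q 0) hDLR (hker q hq)
    -- sum over the six orientations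
    have hdiff : |wilsonTorusMean r.ρ β L r.curvature.F - (C k).mean r.ρ β r.curvature.F| ≤ 12 * (ε * (a β) ^ 4) := by
      rw [wilsonTorusMean_curvature_eq_sum r β L, cellMean_curvature_eq_sum (C k) r β, ← Finset.sum_sub_distrib]
      refine (Finset.abs_sum_le_sum_abs _ _).trans ?_
      have hterm : ∀ q ∈ Finset.univ.filter (fun q : Fin 4 × Fin 4 => q.1 < q.2),
          |torusE G r β L (plane G r q 0) - ∫ U, plane G r q 0 ((C k).lift U) ∂((C k).measure r.ρ β)| ≤
            2 * (ε * (a β) ^ 4) := fun q hq => by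
        have hq' : q.1 < q.2 := (Finset.mem_filter.1 hq).2
        calc |torusE G r β L (plane G r q 0) - ∫ U, plane G r q 0 ((C k).lift U) ∂((C k).measure r.ρ β)|
            ≤ |torusE G r β L (plane G r q 0) - p q β| +
                |p q β - ∫ U, plane G r q 0 ((C k).lift U) ∂((C k).measure r.ρ β)| := abs_sub_le _ _ _
          _ ≤ ε * (a β) ^ 4 + ε * (a β) ^ 4 := add_le_add (hT q hq') (by rw [abs_sub_comm]; exact hCe q hq')
          _ = 2 * (ε * (a β) ^ 4) := by ring
      refine (Finset.sum_le_sum hterm).trans ?_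
      rw [Finset.sum_const, card_planes, nsmul_eq_mul]
      push_cast
      linarith
    -- conclude
    rw [haeq, abs_mul]
    have h4 : |(a β)⁻¹ ^ 4| = ((a β) ^ 4)⁻¹ := by rw [inv_pow, abs_inv, abs_of_pos (by positivity)]
    rw [h4]
    calc ((a β) ^ 4)⁻¹ * |wilsonTorusMean r.ρ β L r.curvature.F - (C k).mean r.ρ β r.curvature.F|
        ≤ ((a β) ^ 4)⁻¹ * (12 * (ε * (a β) ^ 4)) := mul_le_mul_of_nonneg_left hdiff (by positivity)
      _ = 12 * ε := by
          have hne : a β ≠ 0 := (ha β).ne'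
          field_simp
  rw [Metric.tendsto_nhds]
  intro ε hε
  filter_upwards [hmain (ε / 13) (by positivity)] with k hk
  rw [Real.dist_0_eq_abs]
  linarith

end Summit.QuantumFields.YangMills.Theorems.RecentredCoverTransfer

end

/-! ## Registration under the «boundary-law» skeleton of crux `OnePointRate` (stmt-QuantumFields-23142)

The registered skeleton «boundary-law» (LINE g9-D, planner ym-idea-1 g9) names this item as its stub 3,
`Summit.QuantumFields.YangMills.Cruxes.OnePointRate.BoundaryLaw.stub_onePointRateOfBoundaryLaw : OnePointRateOfBoundaryLaw`;
the declaration below records it BY NAME so that the crux registry sees the stub landed (appended 2026-08-28 by width seat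
`ym-line-sfw-p2-w5` g12; previous declarations byte-identical).  After this the skeleton's only open stub is stub 1,
`stub_physicalDepthBoundaryLaw` = the crux `PhysicalDepthBoundaryLaw` (stmt-QuantumFields-23197).  No crux, rung or summit
is proved by this registration. -/

namespace Summit.QuantumFields.YangMills.Cruxes.OnePointRate.BoundaryLaw

/-- **Stub 3 of «boundary-law» (crux stmt-QuantumFields-23142), BY NAME**: the glue
`PhysicalDepthBoundaryLaw → CellCubeDLR → OnePointRate` (= item stmt-QuantumFields-23166, proved above as
`onePointRateOfBoundaryLaw_proof`). [folklore] -/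
theorem stub_onePointRateOfBoundaryLaw :
    Summit.QuantumFields.YangMills.Theses.RecentredCoverTransfer.OnePointRateOfBoundaryLaw :=
  Summit.QuantumFields.YangMills.Theorems.RecentredCoverTransfer.onePointRateOfBoundaryLaw_proof

end Summit.QuantumFields.YangMills.Cruxes.OnePointRate.BoundaryLaw
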